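import Literature.Barriers.CriticalPhenomena.PlaquetteWalkHoleRootThinSide
import HarnessLib

/-!
# Barrier catalogue (SAWScalingLimit): SHUT ROW EAST — removing the cell below the root plaquette's southern neighbour
`w₁`-KILLS the under route (`Im VF(2π/3) > 0`), the corner cell `K_S1` may stay

Leaf of `PlaquetteWalkHoleRootThinSide` (over-block witnesses at every position) in the line of `PlaquetteWalkHoleRootCorridor`
(the eastern closed-corridor kill chain). There the kill row's western door of column `w.1 + 1` — between
`(w.1, w.2 − 2)` and `K_S1 = (w.1 + 1, w.2 − 2)` — is shut by the absence of `K_S1`; it is equally shut when its OTHER face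
`(w.1, w.2 − 2)` (two rows below the root plaquette `w`) is absent. §1–§2 rerun the chain verbatim with the hypothesis
`killSE w ∉ D ∨ (w.1, w.2 − 2) ∉ D` (`ΩG.cross_root_S_or_exists_nth_eq_rootS_E_shutRowE`,
`ΩG.kindsIn_rootS_or_root_eq_of_AJ_ne_zero_under_shutRowE`, `ΩG.not_W1FreeOff_farW_of_wound_under_shutRowE`,
★★★★ `ΩG.under_w1_killed_of_shutRowE`): hole absent, that door shut, a closed corridor taking the usable western doors of
column `w.1 + 1` below the kill row ⇒ every wound class-`B2a` under-walk at the far cell is `w₁`-marked off the far cell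
(two `θ`-corner arcs in `rootS w` or in `w`). §3: with the `w₁`-free over block present ⇒ ★★★★★
`im_vertexFunctional_printed_two_pi_div_three_pos_of_rootSS` (`Im VF(2π/3) > 0`); §4, all boxes with the hole two rows above
the bottom wall (`h.2 = 2`): removing the bottom cell `(h.1 + 1, 0)` below the root plaquette's southern neighbour — the
third of the lane's bottom «residual» cells — forces ★★★★★ `lawL_box_rootSS_im_two_pi_div_three_pos`; mirror
`(h.1 + 1, n − 1)` on the top wall ⇒ `Im VF(π/3) < 0`. (Kit datum j283492 of the lane: in `7×5 ∖ {hole, (4,0)}` the under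
route is even EMPTY up to 44 arcs — a prefix phenomenon not typed here; the `w₁`-kill is what the parity chain gives.)

Not in print; venture lane «pcv-sawmu», seat b-step0 gen 26.

References: A. Glazman, I. Manolescu, arXiv:1708.00395v3, §1 (Fig. 1, Fig. 2), §2.1, §4.2 and Lemma 2.1
[GlazmanManolescu2019]; A. Glazman, Electron. Commun. Probab. 20 (2015) no. 86, Lemma 3.1, proof pp. 6–7
[Glazman2015WeightedSAW]; R. Courant, H. Robbins, *What is Mathematics?* (1941/1958), Ch. V Appendix §2 (the even–odd
rule) [CourantRobbins1958].
-/

noncomputable section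

open Set Function Complex

namespace Literature.Probability.RandomPlanarGeometry.SAW.YangBaxter

open Real
open Literature.Barriers.CriticalPhenomena.PlaquetteWalk (mirrorRowFace mirrorRowFace_mirrorRowFace)

open private side_jOut from Literature.Probability.RandomPlanarGeometry.YangBaxterSAWExcursionJordan

/-- A cell with a side on a side of the far cell lies west of the root plaquette's column (coordinate form).
[cite: GlazmanManolescu2019, §1 (the lattice of rhombi and its mid-edges)] -/
private theorem fst_lt_of_side_eq_farW_side' {w c : Face} {s t : Side} (h : c.side s = (farW w).side t) :
    c.1 < w.1 := by
  obtain ⟨a, b⟩ := w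
  obtain ⟨p, q⟩ := c
  cases s <;> cases t <;>
    simp only [farW, Face.side, MidEdge.vert.injEq, MidEdge.slant.injEq, reduceCtorEq] at h ⊢ <;> omega

namespace ΩG

variable {D : Set Face} {w : Face}

/-! ## §1 The west crossing below the root plaquette, door shut from either side -/

/-- ★★★ **THE WEST CROSSING WITH THE KILL ROW'S EASTERN DOOR SHUT FROM EITHER SIDE** (`K_S1 = (w.1 + 1, w.2 − 2)` OR the
cell `(w.1, w.2 − 2)` two rows below the root plaquette absent; otherwise verbatim the closed-corridor form of
`PlaquetteWalkHoleRootCorridor`): a closed corridor `R` below the kill row; every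
western door of column `w.1 + 1` at a row `≤ w.2 − 3` absent or leading into `R`. Then a class-`B2a` walk at the far
cell whose excursion winds around the root crosses the bottom side of the root plaquette or the `E` side of the cell
below it: the excursion's crossings of `R`'s doors are even (it starts and ends outside `R`), its west-edge crossings
of the quadrant are odd, the kill row's door is shut — so the crossings at row `w.2 − 1` are odd.
[cite: CourantRobbins1958, Ch. V Appendix §2 (the even–odd rule)] [cite: Glazman2015WeightedSAW, Lemma 3.1 (proof, pp. 6–7)] -/
theorem cross_root_S_or_exists_nth_eq_rootS_E_shutRowE (hK : killSE w ∉ D ∨ ((w.1, w.2 - 2) : Face) ∉ D) {R : Set Face} (hR : IsCorridorS w D R)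
    (hcol : ∀ y : ℤ, y ≤ w.2 - 3 → (w.1, y) ∉ D ∨ (w.1 + 1, y) ∉ D ∨ ((w.1 + 1, y) : Face) ∈ R)
    (ω : ΩG D (w.side .W) (farW w)) (hr : RootedFace D (w.side .W) (farW w)) (h : ω.IsB2a)
    (hA : ω.AJ hr h (toC (midPt (w.side .W))) ≠ 0) :
    (∃ i, ω.2.firstHitG ≤ i ∧ i < ω.2.arcs.length ∧ ω.2.nth (i + 1) = w.side .S) ∨
      ∃ i, ω.2.firstHitG ≤ i ∧ i < ω.2.arcs.length ∧ ω.2.nth (i + 1) = (rootS w).side .E := by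
  classical
  rcases ω.cross_root_S_or_odd_card_westEdgeSE hr h hA with hc | hodd
  · exact Or.inl hc
  right
  have hF := ω.fh_lt h
  have hB2 : ω.2.firstHitG + 1 < ω.2.arcs.length := h.1
  set F := ω.2.firstHitG with hFdef
  set n := ω.2.arcs.length with hndef
  set K := Finset.Ioc (F + 1) (n - 1) with hKdef
  set E := K.filter fun k => IsWestEdgeSE w (ω.2.nth k) with hEdef
  -- membership in the corridor along the walk
  let bR : ℕ → Bool := fun k => decide (ω.2.fc k ∈ R)
  have hxR : ∀ {c : Face}, c.1 ≤ w.1 → c ∉ R := fun hc hcR => by have := (hR _ hcR).1; omega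
  have hbF : bR (F + 1) = false := by
    have hin := (ω.2.side_sIn_nth (i := F + 1) hB2).1
    rw [(ω.2.exitSide_specG hr hF).1] at hin
    simp only [bR, decide_eq_false_iff_not]
    exact hxR (by have := fst_lt_of_side_eq_farW_side' hin; omega)
  have hbL : bR (n - 1) = false := by
    have hout := (ω.2.side_sIn_nth (i := n - 1) (by omega)).2.1
    rw [show n - 1 + 1 = n by omega, ω.2.nth_length] at hout
    simp only [bR, decide_eq_false_iff_not]
    exact hxR (by have := fst_lt_of_side_eq_farW_side' hout; omega)
  have hevenR := (even_card_changes_iff bR (F + 1) (n - 1) (by omega)).2 (hbF.trans hbL.symm)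
  -- the two faces of the `k`-th edge are the cells of arcs `k - 1`, `k`
  have hfaces : ∀ k ∈ K, ((ω.2.nth k).faces.1 ∈ D ∧ (ω.2.nth k).faces.2 ∈ D) ∧
      ((ω.2.fc (k - 1) = (ω.2.nth k).faces.1 ∧ ω.2.fc k = (ω.2.nth k).faces.2) ∨
        (ω.2.fc (k - 1) = (ω.2.nth k).faces.2 ∧ ω.2.fc k = (ω.2.nth k).faces.1)) := by
    intro k hk
    rw [hKdef, Finset.mem_Ioc] at hk
    have hout := (ω.2.side_sIn_nth (i := k - 1) (by omega)).2.1
    have hin := (ω.2.side_sIn_nth (i := k) (by omega)).1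
    rw [show k - 1 + 1 = k by omega] at hout
    have hne : ω.2.fc (k - 1) ≠ ω.2.fc (k - 1 + 1) := YBWalk.fc_succ_ne (by omega)
    rw [show k - 1 + 1 = k by omega] at hne
    refine ⟨ω.2.door_nth (j := k) (by omega) (by omega), ?_⟩
    rcases (Face.exists_side_eq_iff _ _).1 ⟨_, hout⟩ with e1 | e1 <;>
      rcases (Face.exists_side_eq_iff _ _).1 ⟨_, hin⟩ with e2 | e2
    · exact absurd (e1.trans e2.symm) hne
    · exact Or.inl ⟨e1, e2⟩
    · exact Or.inr ⟨e1, e2⟩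
    · exact absurd (e1.trans e2.symm) hne
  -- a corridor-door crossing is a west-edge crossing at a row `≤ w.2 - 3`
  have hflip : ∀ k ∈ K, bR (k - 1) ≠ bR k → ∃ y : ℤ, y ≤ w.2 - 3 ∧ ω.2.nth k = MidEdge.vert (w.1 + 1) y := by
    intro k hk hb
    obtain ⟨hd, hf⟩ := hfaces k hk
    refine exists_eq_vert_of_corridor_door hR hd ?_
    simp only [bR, ne_eq, decide_eq_decide] at hb
    rcases hf with ⟨e1, e2⟩ | ⟨e1, e2⟩
    · rw [← e1, ← e2]; exact hb
    · rw [← e1, ← e2]; exact fun hh => hb hh.symm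
  -- a west-edge crossing that is not a corridor-door crossing is at row `w.2 - 1`
  have hrest : ∀ k ∈ E, ¬(bR (k - 1) ≠ bR k) → ω.2.nth k = (rootS w).side .E := by
    intro k hk hb
    rw [hEdef, Finset.mem_filter] at hk
    obtain ⟨hkK, hwest⟩ := hk
    obtain ⟨hd, hf⟩ := hfaces k hkK
    push Not at hb
    cases hnth : ω.2.nth k with
    | slant x y => rw [hnth] at hwest; exact absurd hwest (by simp [IsWestEdgeSE])
    | vert x y =>
      rw [hnth] at hwest hd hf
      simp only [IsWestEdgeSE] at hwest
      obtain ⟨hx, hy⟩ := hwest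
      subst hx
      simp only [MidEdge.faces, add_sub_cancel_right] at hd hf
      have hy1 : y = w.2 - 1 := by
        rcases lt_or_eq_of_le hy with hlt | heq
        · exfalso
          rcases lt_or_eq_of_le (show y ≤ w.2 - 2 by omega) with hlt2 | heq2
          · rcases hcol y (by omega) with hc | hc | hcR
            · exact hc hd.1
            · exact hc hd.2
            · -- the door leads into the corridor: the crossing IS a corridor-door crossing
              have hW : ((w.1, y) : Face) ∉ R := hxR le_rfl
              simp only [bR, decide_eq_decide] at hb
              rcases hf with ⟨e1, e2⟩ | ⟨e1, e2⟩
              · rw [e1, e2] at hb; exact hW (hb.2 hcR)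
              · rw [e1, e2] at hb; exact hW (hb.1 hcR)
          · rcases hK with hK | hK
            · apply hK
              have e : killSE w = (w.1 + 1, y) := by rw [heq2]; rfl
              rw [e]; exact hd.2
            · apply hK
              have e : ((w.1, w.2 - 2) : Face) = (w.1, y) := by rw [heq2]
              rw [e]; exact hd.1
        · exact heq
      rw [hy1]; obtain ⟨a, c⟩ := w; simp [rootS, Face.side]
  -- counting: the corridor-door crossings in `K` are exactly the flips of `bR`, all in `E`; they are even
  have hsub : (K.filter fun k => bR (k - 1) ≠ bR k) = E.filter fun k => bR (k - 1) ≠ bR k := by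
    ext k
    simp only [hEdef, Finset.mem_filter]
    constructor
    · rintro ⟨hk, hb⟩
      obtain ⟨y, hy, e⟩ := hflip k hk hb
      exact ⟨⟨hk, by rw [e]; exact ⟨rfl, by omega⟩⟩, hb⟩
    · rintro ⟨⟨hk, -⟩, hb⟩; exact ⟨hk, hb⟩
  rw [hsub] at hevenR
  have hcard := Finset.card_filter_add_card_filter_not (s := E) (fun k => bR (k - 1) ≠ bR k)
  have hodd' : Odd (E.filter fun k => ¬(bR (k - 1) ≠ bR k)).card := by
    rcases Nat.even_or_odd (E.filter fun k => ¬(bR (k - 1) ≠ bR k)).card with he | he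
    · exfalso
      rw [← hcard] at hodd
      exact Nat.not_even_iff_odd.2 hodd (hevenR.add he)
    · exact he
  obtain ⟨k, hk⟩ := Finset.card_pos.1 hodd'.pos
  rw [Finset.mem_filter] at hk
  have hkK : k ∈ K := (Finset.mem_filter.1 hk.1).1
  rw [hKdef, Finset.mem_Ioc] at hkK
  refine ⟨k - 1, by omega, by omega, ?_⟩
  rw [show k - 1 + 1 = k by omega]
  exact hrest k hk.1 hk.2

/-! ## §4 The `K_S1` kill, corridor form -/

/-- ★★★ **THE DICHOTOMY FOR A WOUND UNDER-WALK, shut-row form** (as the corridor form, the kill row's door shut from either side). [cite: GlazmanManolescu2019, §1, Fig. 1 (two arcs at the two θ-corners weigh w₁)]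
[cite: CourantRobbins1958, Ch. V Appendix §2 (the even–odd rule)] [cite: Glazman2015WeightedSAW, Lemma 3.1 (proof, pp. 6–7)] -/
theorem kindsIn_rootS_or_root_eq_of_AJ_ne_zero_under_shutRowE (hh : holeFaceW w ∉ D) (hK : killSE w ∉ D ∨ ((w.1, w.2 - 2) : Face) ∉ D)
    {R : Set Face} (hR : IsCorridorS w D R)
    (hcol : ∀ y : ℤ, y ≤ w.2 - 3 → (w.1, y) ∉ D ∨ (w.1 + 1, y) ∉ D ∨ ((w.1 + 1, y) : Face) ∈ R)
    (ω : ΩG D (w.side .W) (farW w)) (hr : RootedFace D (w.side .W) (farW w)) (h : ω.IsB2a)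
    (hS : ω.2.firstSideG = .S) (hA : ω.AJ hr h (toC (midPt (w.side .W))) ≠ 0) :
    ω.2.kindsIn (rootS w) = [.corner, .corner] ∨ ω.2.kindsIn w = [.corner, .corner] := by
  have hF := ω.fh_lt h
  rcases ω.cross_root_S_or_exists_nth_eq_rootS_E_shutRowE hK hR hcol hr h hA with ⟨i, hFi, hin, e⟩ | ⟨i, hFi, hin, e⟩
  · exact Or.inr (ω.kindsIn_root_eq_of_cross_root_S hh hr h ⟨i, hFi, hin, e⟩).2
  · left
    have hi1 : i + 1 < ω.2.arcs.length := by
      rcases Nat.lt_or_ge (i + 1) ω.2.arcs.length with hl | hl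
      · exact hl
      · exfalso
        have e' : i + 1 = ω.2.arcs.length := by omega
        rw [e', ω.2.nth_length] at e
        exact farW_side_ne_rootS_side w ω.1 .E e
    have hFi' : ω.2.firstHitG < i := by
      rcases Nat.lt_or_ge ω.2.firstHitG i with hl | hl
      · exact hl
      · exfalso
        have eF : i = ω.2.firstHitG := by omega
        have e1 : ω.2.nth (ω.2.firstHitG + 1) = (farW w).side (ω.z1 hr h) := (ω.2.exitSide_specG hr hF).1
        rw [eF, e1] at e
        exact farW_side_ne_rootS_side w _ .E e
    have hJ : ∃ j, j < ω.Mv ∧ (ω.jFace h j).side (ω.jOut hr h j) = (rootS w).side .E := by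
      refine ⟨i - ω.2.firstHitG, by unfold ΩG.Mv; omega, ?_⟩
      rw [side_jOut (hr := hr) h (by unfold ΩG.Mv; omega),
        show ω.2.firstHitG + (i - ω.2.firstHitG) + 1 = i + 1 by omega, e]
    obtain ⟨i₀, hi₀1, hi₀F, hnth₀⟩ := exists_prefix_nth_eq_root_S_of_cross_rootS_E hh hr ω h hS hJ
    exact kindsIn_rootS_eq_of_prefix_cross_of_cross_rootS_E ω hr h ⟨i₀, hi₀1, hi₀F, hnth₀⟩ ⟨i, hFi, hin, e⟩

/-- ★★★★ **THE STRUCTURAL UNDER-ROUTE `w₁`-KILL WITH THE DOOR SHUT FROM EITHER SIDE**: hole, `K_S1` OR `(w.1, w.2 − 2)`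
absent, a closed corridor taking every usable western
door of column `w.1 + 1` below the kill row ⇒ every WOUND class-`B2a` UNDER-walk at the far cell is NOT `w₁`-free off
the far cell. [cite: GlazmanManolescu2019, §1, Fig. 1 and the remark after eq. (1) («w₁ = 0 at θ = 2π/3»)]
[cite: CourantRobbins1958, Ch. V Appendix §2 (the even–odd rule)] [cite: Glazman2015WeightedSAW, Lemma 3.1 (proof, pp. 6–7)] -/
theorem not_W1FreeOff_farW_of_wound_under_shutRowE (hh : holeFaceW w ∉ D) (hK : killSE w ∉ D ∨ ((w.1, w.2 - 2) : Face) ∉ D)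
    {R : Set Face} (hR : IsCorridorS w D R)
    (hcol : ∀ y : ℤ, y ≤ w.2 - 3 → (w.1, y) ∉ D ∨ (w.1 + 1, y) ∉ D ∨ ((w.1 + 1, y) : Face) ∈ R)
    (ω : ΩG D (w.side .W) (farW w)) (hr : RootedFace D (w.side .W) (farW w)) (h : ω.IsB2a)
    (hS : ω.2.firstSideG = .S) {θ : ℝ}
    (hW : ω.WE (fun _ => θ) ≠ excursionWinding θ ω.2.firstSideG (ω.z1 hr h) ω.1) : ¬ω.2.W1FreeOff (farW w) := by
  have key : ω.2.kindsIn (rootS w) = [.corner, .corner] ∨ ω.2.kindsIn w = [.corner, .corner] := by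
    rcases ω.AJ_ne_zero_or_rev_of_wound hr h θ hW with hA | hA
    · exact kindsIn_rootS_or_root_eq_of_AJ_ne_zero_under_shutRowE hh hK hR hcol ω hr h hS hA
    · have h' := ω.rev_isB2a hr h
      have hS' : (ω.rev hr).2.firstSideG = .S := by rw [ω.rev_firstSide hr h]; exact hS
      have perm : ∀ {g : Face}, g ≠ farW w → (ω.rev hr).2.kindsIn g = [.corner, .corner] →
          ω.2.kindsIn g = [.corner, .corner] := by
        intro g hg hk
        have hperm := ω.kindsIn_rev_perm hr h hg
        rw [hk] at hperm
        have hp : (ω.2.kindsIn g).Perm (List.replicate 2 .corner) := hperm.symm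
        exact List.perm_replicate.1 hp
      rcases kindsIn_rootS_or_root_eq_of_AJ_ne_zero_under_shutRowE hh hK hR hcol (ω.rev hr) hr h' hS' hA with hk | hk
      · exact Or.inl (perm (rootS_ne_farW w) hk)
      · exact Or.inr (perm (root_ne_farW w) hk)
  intro hfree
  rcases key with hk | hk
  · have hmem : rootS w ∈ ω.2.facesVisited := by
      by_contra hn
      rw [YBWalk.kindsIn_eq_nil hn] at hk
      exact List.cons_ne_nil _ _ hk.symm
    exact hfree _ hmem (rootS_ne_farW w) hk
  · have hmem : w ∈ ω.2.facesVisited := by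
      by_contra hn
      rw [YBWalk.kindsIn_eq_nil hn] at hk
      exact List.cons_ne_nil _ _ hk.symm
    exact hfree _ hmem (root_ne_farW w) hk

/-- ★★★★ «Every wound under-walk is `w₁`-marked off the far cell», shut-row form — in particular when ONLY the cell
`(w.1, w.2 − 2)` below the root plaquette's southern neighbour is absent (`K_S1` present).
[cite: GlazmanManolescu2019, §1, remark after eq. (1)] [cite: CourantRobbins1958, Ch. V Appendix §2 (the even–odd rule)] -/
theorem under_w1_killed_of_shutRowE (hh : holeFaceW w ∉ D) (hK : killSE w ∉ D ∨ ((w.1, w.2 - 2) : Face) ∉ D)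
    {R : Set Face} (hR : IsCorridorS w D R)
    (hcol : ∀ y : ℤ, y ≤ w.2 - 3 → (w.1, y) ∉ D ∨ (w.1 + 1, y) ∉ D ∨ ((w.1 + 1, y) : Face) ∈ R)
    (hr : RootedFace D (w.side .W) (farW w)) (θ : ℝ) :
    ∀ (ω : ΩG D (w.side .W) (farW w)) (h : ω.IsB2a), ω.2.firstSideG = .S →
      ω.WE (fun _ => θ) ≠ excursionWinding θ ω.2.firstSideG (ω.z1 hr h) ω.1 → ¬ω.2.W1FreeOff (farW w) :=
  fun ω h hS hW => not_W1FreeOff_farW_of_wound_under_shutRowE hh hK hR hcol ω hr h hS hW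

/-! ## §2b Row mirror: the cell above the root plaquette's northern neighbour -/

/-- The reflection on a cell, in coordinates. [cite: GlazmanManolescu2019, §4.2 (lattice symmetries)] -/
private theorem mirrorRowFace_mkRE (w : Face) (x y : ℤ) : mirrorRowFace w.2 ((x, y) : Face) = (x, 2 * w.2 - y) := by
  simp [mirrorRowFace]

/-- ★★★★ **THE OVER ROUTE IS `w₂`-KILLED WITH THE NORTHERN DOOR SHUT FROM EITHER SIDE** (row mirror): hole, `K_N2` OR
`(w.1, w.2 + 2)` absent, a closed corridor above the kill row ⇒ every wound over-walk is `w₂`-marked off the far cell.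
[cite: GlazmanManolescu2019, §1 (the paragraph of Fig. 2), §4.2 (lattice symmetries), Lemma 2.1]
[cite: Glazman2015WeightedSAW, Lemma 3.1 (proof, pp. 6–7)] [cite: CourantRobbins1958, Ch. V Appendix §2 (the even–odd rule)] -/
theorem over_w2_killed_of_shutRowNE (hh : holeFaceW w ∉ D) (hK : killNE w ∉ D ∨ ((w.1, w.2 + 2) : Face) ∉ D)
    {R : Set Face} (hR : IsCorridorN w D R)
    (hcol : ∀ y : ℤ, w.2 + 3 ≤ y → (w.1, y) ∉ D ∨ (w.1 + 1, y) ∉ D ∨ ((w.1 + 1, y) : Face) ∈ R)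
    (hr : RootedFace D (w.side .W) (farW w)) (θ : ℝ) :
    ∀ (ω : ΩG D (w.side .W) (farW w)) (h : ω.IsB2a), ω.2.firstSideG = .N →
      ω.WE (fun _ => θ) ≠ excursionWinding θ ω.2.firstSideG (ω.z1 hr h) ω.1 → ¬ω.2.W2FreeOff (farW w) := by
  intro ω h hN hW
  have hr' := rootedFace_rowMirrorDom w hr
  have h' := ω.mirrorFar_isB2a hr h
  have hh' : holeFaceW w ∉ rowMirrorDom w D := by rwa [mem_rowMirrorDom, mirrorRowFace_holeFaceW]
  have hK' : killSE w ∉ rowMirrorDom w D ∨ ((w.1, w.2 - 2) : Face) ∉ rowMirrorDom w D := by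
    rcases hK with hK | hK
    · left; rwa [mem_rowMirrorDom, mirrorRowFace_killSE]
    · right; rw [mem_rowMirrorDom, mirrorRowFace_mkRE, show 2 * w.2 - (w.2 - 2) = w.2 + 2 by ring]; exact hK
  have hR' := isCorridorS_rowMirrorDom hR
  have hcol' : ∀ y : ℤ, y ≤ w.2 - 3 → (w.1, y) ∉ rowMirrorDom w D ∨ (w.1 + 1, y) ∉ rowMirrorDom w D ∨
      ((w.1 + 1, y) : Face) ∈ rowMirrorDom w R := by
    intro y hy
    simp only [mem_rowMirrorDom, mirrorRowFace_mkRE]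
    exact hcol (2 * w.2 - y) (by omega)
  have hS' : ω.mirrorFar.2.firstSideG = .S := by rw [ω.mirrorFar_firstSideG, hN]; rfl
  have hkill := not_W1FreeOff_farW_of_wound_under_shutRowE hh' hK' hR' hcol' ω.mirrorFar hr' h' hS'
    (ω.mirrorFar_wound hr h hW)
  intro hfree
  apply hkill
  intro g hg hgf hk
  have hk2 := ω.kindsIn_eq_coCorner_of_mirrorFar_corner hk
  have hmem : mirrorRowFace w.2 g ∈ ω.2.facesVisited := by
    by_contra hn
    rw [YBWalk.kindsIn_eq_nil hn] at hk2
    exact List.cons_ne_nil _ _ hk2.symm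
  have hne : mirrorRowFace w.2 g ≠ farW w := by
    intro e
    apply hgf
    have e' := congrArg (mirrorRowFace w.2) e
    rw [mirrorRowFace_mirrorRowFace, mirrorRowFace_farW] at e'
    exact e'
  exact hfree _ hmem hne hk2

end ΩG

end Literature.Probability.RandomPlanarGeometry.SAW.YangBaxter

namespace Literature.Barriers.CriticalPhenomena.PlaquetteWalk

open Literature.Probability.RandomPlanarGeometry.SAW.YangBaxter
open Real Complex

/-! ## §3 The sign at the dual angle -/

section Signs

variable {Dl : List Face} {w : Face}

/-- ★★★★★ **CELL BELOW THE ROOT PLAQUETTE'S SOUTHERN NEIGHBOUR (or `K_S1`) ABSENT ⇒ `Im VF(2π/3) > 0`**: hole absent, the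
door `(w.1, w.2 − 2) | (w.1 + 1, w.2 − 2)` shut from either side, a closed corridor for the usable western doors of column
`w.1 + 1` below the kill row, the `w₁`-free over block present ⇒ the under route is `w₁`-killed and the over route free.
[cite: GlazmanManolescu2019, Lemma 2.1 (statement, "in the form given in [Gl]"), §1 (remark after eq. (1))]
[cite: Glazman2015WeightedSAW, Lemma 3.1 (proof, pp. 6–7)] [cite: CourantRobbins1958, Ch. V Appendix §2 (the even–odd rule)] -/
theorem im_vertexFunctional_printed_two_pi_div_three_pos_of_rootSS (hBE : ∀ c ∈ overBlockE w, c ∈ Dl)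
    (hf : farW w ∈ Dl) (hh : holeFaceW w ∉ dom Dl) (hK : killSE w ∉ dom Dl ∨ ((w.1, w.2 - 2) : Face) ∉ dom Dl)
    {R : Set Face} (hR : IsCorridorS w (dom Dl) R)
    (hcolS : ∀ y : ℤ, y ≤ w.2 - 3 → (w.1, y) ∉ dom Dl ∨ (w.1 + 1, y) ∉ dom Dl ∨ ((w.1 + 1, y) : Face) ∈ R) :
    0 < (vertexFunctional (printedWeights (2 * π / 3)) tFiveEighths (ybCoeff (2 * π / 3)) Dl (w.side .W)
      (farW w)).im := by
  have hr : RootedFace (dom Dl) (w.side .W) (farW w) := ⟨hf, fun hb => hh (by rw [root_faces_W] at hb; exact hb.1)⟩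
  exact im_vertexFunctional_printed_farCellW_two_pi_div_three_pos_of_under_killed Dl w hf hh hr
    (ΩG.under_w1_killed_of_shutRowE hh hK hR hcolS hr _) (exists_over_w1free_of_overBlockE hBE hr _)

/-- ★★★★★ **CELL ABOVE THE ROOT PLAQUETTE'S NORTHERN NEIGHBOUR (or `K_N2`) ABSENT ⇒ `Im VF(π/3) < 0`** (row mirror, with the
`w₂`-free under block). [cite: GlazmanManolescu2019, Lemma 2.1 (statement, "in the form given in [Gl]"), §1 (the paragraph of Fig. 2)]
[cite: Glazman2015WeightedSAW, Lemma 3.1 (proof, pp. 6–7)] [cite: CourantRobbins1958, Ch. V Appendix §2 (the even–odd rule)] -/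
theorem im_vertexFunctional_printed_pi_div_three_neg_of_rootNN (hBE : ∀ c ∈ underBlockE w, c ∈ Dl)
    (hf : farW w ∈ Dl) (hh : holeFaceW w ∉ dom Dl) (hK : killNE w ∉ dom Dl ∨ ((w.1, w.2 + 2) : Face) ∉ dom Dl)
    {R : Set Face} (hR : IsCorridorN w (dom Dl) R)
    (hcolN : ∀ y : ℤ, w.2 + 3 ≤ y → (w.1, y) ∉ dom Dl ∨ (w.1 + 1, y) ∉ dom Dl ∨ ((w.1 + 1, y) : Face) ∈ R) :
    (vertexFunctional (printedWeights (π / 3)) tFiveEighths (ybCoeff (π / 3)) Dl (w.side .W) (farW w)).im < 0 := by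
  have hr : RootedFace (dom Dl) (w.side .W) (farW w) := ⟨hf, fun hb => hh (by rw [root_faces_W] at hb; exact hb.1)⟩
  exact im_vertexFunctional_printed_farCellW_pi_div_three_neg_of_over_killed Dl w hf hh hr
    (ΩG.over_w2_killed_of_shutRowNE hh hK hR hcolN hr _) (exists_under_w2free_of_underBlockE hBE hr _)

end Signs

/-! ## §4 LAW L's residual bottom cell below the root plaquette's southern neighbour, all boxes -/

section Boxes

variable {m n : ℕ} {h : Face}

/-- ★★★★★ **LAW L's RESIDUAL CELL BELOW `rootS`, ALL BOXES: `Im VF(2π/3) > 0`.** In the `m × n` box with the hole `h` two rows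
above the bottom wall (`h.2 = 2`, `2 ≤ h.1`, `h.1 + 3 ≤ m`, `h.2 + 3 ≤ n`), removing the bottom cell `(h.1 + 1, 0)` alone
(below the southern neighbour of the root plaquette `(h.1 + 1, 2)`) makes every wound under-walk at the far cell
`w₁`-marked and leaves the over route `w₁`-free: the imaginary part of the far-cell defect at `θ = 2π/3` is strictly
positive. [cite: GlazmanManolescu2019, Lemma 2.1 (statement, "in the form given in [Gl]"), §2.1]
[cite: Glazman2015WeightedSAW, Lemma 3.1 (proof, pp. 6–7)] -/
theorem lawL_box_rootSS_im_two_pi_div_three_pos (hW : 2 ≤ h.1) (hE : h.1 + 3 ≤ m) (hS : h.2 = 2) (hN : h.2 + 3 ≤ n) :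
    0 < (vertexFunctional (printedWeights (2 * π / 3)) tFiveEighths (ybCoeff (2 * π / 3))
      (boxMinus m n [h, (h.1 + 1, 0)]) (Face.side (h.1 + 1, h.2) .W) (farW (h.1 + 1, h.2))).im := by
  have bE : ∀ c ∈ overBlockE42, 1 ≤ c.1 ∧ c.1 ≤ 5 ∧ 1 ≤ c.2 ∧ c.2 ≤ 4 ∧ c ≠ (3, 2) := by decide
  have hBE : ∀ c ∈ overBlockE (h.1 + 1, h.2), c ∈ boxMinus m n [h, (h.1 + 1, 0)] := by
    intro c hc
    simp only [overBlockE, List.mem_map] at hc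
    obtain ⟨a, ha, rfl⟩ := hc
    obtain ⟨b1, b2, b3, b4, b5⟩ := bE a ha
    obtain ⟨x, y⟩ := a
    simp only [ne_eq, Prod.mk.injEq, not_and] at b1 b2 b3 b4 b5
    rw [shiftBy_refShift_mk, mem_boxMinus]
    simp only [List.mem_cons, List.not_mem_nil, or_false, not_or]
    refine ⟨⟨by omega, by omega, by omega, by omega⟩, fun e => ?_, fun e => ?_⟩
    · have e' := Prod.ext_iff.1 e; simp only at e'; omega
    · have e' := Prod.ext_iff.1 e; simp only at e'; omega
  refine im_vertexFunctional_printed_two_pi_div_three_pos_of_rootSS hBE ?_ ?_ (Or.inr ?_)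
    (R := {c | c ∈ dom (boxMinus m n [h, (h.1 + 1, 0)]) ∧ h.1 + 2 ≤ c.1 ∧ c.2 ≤ h.2 - 3}) ?_ fun y hy => ?_
  · rw [mem_boxMinus]; simp only [farW, List.mem_cons, List.not_mem_nil, or_false, not_or]
    refine ⟨⟨by omega, by omega, by omega, by omega⟩, fun e => ?_, fun e => ?_⟩
    · have e' := Prod.ext_iff.1 e; simp only at e'; omega
    · have e' := Prod.ext_iff.1 e; simp only at e'; omega
  · rw [holeFaceW_hroot]; exact not_mem_dom_boxMinus_of_mem (by simp)
  · have e : (((h.1 + 1, h.2).1, (h.1 + 1, h.2).2 - 2) : Face) = (h.1 + 1, 0) := Prod.ext (by simp only) (by simp only; omega)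
    rw [e]; exact not_mem_dom_boxMinus_of_mem (by simp)
  · -- the corridor below the kill row is EMPTY in this box (no rows below row 0)
    intro c hc
    simp only [Set.mem_setOf_eq] at hc
    obtain ⟨hcD, -, hc2⟩ := hc
    have hb := (mem_dom_boxMinus.1 hcD).1
    omega
  · left; intro hm; have hb := (mem_dom_boxMinus.1 hm).1; simp only at hb hy; omega

/-- ★★★★★ **THE TOP-WALL MIRROR: removing `(h.1 + 1, n − 1)` above the root plaquette's northern neighbour (hole two rows
below the top wall) ⇒ `Im VF(π/3) < 0`.** [cite: GlazmanManolescu2019, Lemma 2.1 (statement, "in the form given in [Gl]"), §2.1]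
[cite: Glazman2015WeightedSAW, Lemma 3.1 (proof, pp. 6–7)] -/
theorem lawL_box_rootNN_im_pi_div_three_neg (hW : 2 ≤ h.1) (hE : h.1 + 3 ≤ m) (hS : 2 ≤ h.2) (hN : h.2 + 3 = n) :
    (vertexFunctional (printedWeights (π / 3)) tFiveEighths (ybCoeff (π / 3))
      (boxMinus m n [h, (h.1 + 1, h.2 + 2)]) (Face.side (h.1 + 1, h.2) .W) (farW (h.1 + 1, h.2))).im < 0 := by
  have bE : ∀ c ∈ underBlockE42, 1 ≤ c.1 ∧ c.1 ≤ 5 ∧ 0 ≤ c.2 ∧ c.2 ≤ 3 ∧ c ≠ (3, 2) := by decide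
  have hBE : ∀ c ∈ underBlockE (h.1 + 1, h.2), c ∈ boxMinus m n [h, (h.1 + 1, h.2 + 2)] := by
    intro c hc
    simp only [underBlockE, List.mem_map] at hc
    obtain ⟨a, ha, rfl⟩ := hc
    obtain ⟨b1, b2, b3, b4, b5⟩ := bE a ha
    obtain ⟨x, y⟩ := a
    simp only [ne_eq, Prod.mk.injEq, not_and] at b1 b2 b3 b4 b5
    rw [shiftBy_refShift_mk, mem_boxMinus]
    simp only [List.mem_cons, List.not_mem_nil, or_false, not_or]
    refine ⟨⟨by omega, by omega, by omega, by omega⟩, fun e => ?_, fun e => ?_⟩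
    · have e' := Prod.ext_iff.1 e; simp only at e'; omega
    · have e' := Prod.ext_iff.1 e; simp only at e'; omega
  refine im_vertexFunctional_printed_pi_div_three_neg_of_rootNN hBE ?_ ?_ (Or.inr ?_)
    (R := {c | c ∈ dom (boxMinus m n [h, (h.1 + 1, h.2 + 2)]) ∧ h.1 + 2 ≤ c.1 ∧ h.2 + 3 ≤ c.2}) ?_ fun y hy => ?_
  · rw [mem_boxMinus]; simp only [farW, List.mem_cons, List.not_mem_nil, or_false, not_or]
    refine ⟨⟨by omega, by omega, by omega, by omega⟩, fun e => ?_, fun e => ?_⟩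
    · have e' := Prod.ext_iff.1 e; simp only at e'; omega
    · have e' := Prod.ext_iff.1 e; simp only at e'; omega
  · rw [holeFaceW_hroot]; exact not_mem_dom_boxMinus_of_mem (by simp)
  · have e : (((h.1 + 1, h.2).1, (h.1 + 1, h.2).2 + 2) : Face) = (h.1 + 1, h.2 + 2) := Prod.ext (by simp only) (by simp only)
    rw [e]; exact not_mem_dom_boxMinus_of_mem (by simp)
  · intro c hc
    simp only [Set.mem_setOf_eq] at hc
    obtain ⟨hcD, -, hc2⟩ := hc
    have hb := (mem_dom_boxMinus.1 hcD).1
    omega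
  · left; intro hm; have hb := (mem_dom_boxMinus.1 hm).1; simp only at hb hy; omega

end Boxes

end Literature.Barriers.CriticalPhenomena.PlaquetteWalk
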